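import Summits.AtomisticToContinuum.HydrodynamicLimit.Theorems.OneFlightGossipEngineAssemblyEntropyTransport
import Literature.Probability.Divergences.KLDivConvexity
import Literature.MathematicalPhysics.KineticTheory.HardSphereEulerProofs
import HarnessLib

/-!
# Entropy-level quasi-invariance of the local Gibbs law from Rényi quasi-invariance
# (registered stub `stub_entropyQuasiInvariance_of_renyi` (S5) of line `local-gibbs-entropy-ledger`,
# crux `KineticCurrentsWindowLDUniform`, stmt-AtomisticToContinuum-14662)

Let `λ = ψ dL` be the local Gibbs law of `N + 1` hard spheres on `𝕋³` (`ψ` the canonical density of the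
local Gibbs profile, `L` the Liouville measure) and `Φ` a hard-sphere flow. S4 (`stub_windowRenyi`,
taken here as a HYPOTHESIS) asserts the Rényi quasi-invariance of order `p > 1` of `λ` over a kinetic
window: `∫ (ψ∘Φ_{-r})^p ψ^{1-p} dL ≤ e^{pδ(N+1)}` for `r ≤ τ(N+1)^{-1/3}` and large `N`. This file turns
it into the ENTROPY-LEVEL statement consumed by the ledger assembly: with `c = p/(p-1)`,
`KL((Φ_r)_* P ‖ λ) ≤ c · KL(P ‖ λ) + δ(N+1)` for EVERY probability law `P` of the initial data.

* `eqi_lintegral_mul_exp_le` — Hölder in `ℝ≥0∞` with exponents `(c, p)`: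
  `∫ ρ e^{φ/c} dL ≤ (∫ ρ' e^{φ} dL)^{1/c} (∫ ρ^p ρ'^{1-p} dL)^{1/p}` (`ρ' ≠ 0, ∞` a.e.);
* `eqi_mul_log_le` — its logarithmic form `c log ∫ e^{φ/c} d(ρL) ≤ log ∫ e^φ d(ρ'L) + E` under the
  Rényi bound `∫ ρ^p ρ'^{1-p} dL ≤ e^{(p-1)E}`;
* `eqi_klDiv_le_of_renyi` — the reusable abstract core: for probability measures `ρL`, `ρ'L` with that
  Rényi bound and ANY probability `P`, `KL(P ‖ ρ'L) ≤ c KL(P ‖ ρL) + E` (easy half of Donsker–Varadhan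
  with the test function `φ/c`, the log-Hölder step, hard half of Donsker–Varadhan);
* `eqi_lintegral_renyi_comp_flow` — the Liouville change of variables `z ↦ Φ_{-r} z` identifying
  `∫ ψ^p (ψ∘Φ_r)^{1-p} dL` with S4's integral;
* `eqi_fixed` — the statement at fixed `N, r`: transport `KL((Φ_r)_*P ‖ λ) = KL(P ‖ (Φ_{-r})_*λ)`
  (`Theorems.klDiv_lawAt_eq`) and `(Φ_{-r})_*λ = (ψ∘Φ_r) dL` (mild Liouville equation), then the core
  with `ρ = ψ`, `ρ' = ψ∘Φ_r` (positive on the invariant conull good set);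
* `stub_entropyQuasiInvariance_of_renyi` — the registered stub (apply S4 with `δ' = δ(p-1)/p`).
-/

noncomputable section

open MeasureTheory Set Filter InformationTheory ProbabilityTheory
open scoped ENNReal Topology

namespace Summit.AtomisticToContinuum.HydrodynamicLimit.Theorems.KineticCurrentsWindowLDUniformLocalGibbs

open Literature.Analysis.FluidPDE (HardSphereFlow Config canonicalDensity hardSphereDomain liouville
  particleLaw_eq)
open Literature.MathematicalPhysics.KineticTheory (T3 V3 hsDiameter localGibbsLaw localGibbsProfile
  measurable_canonicalDensity measurable_localGibbsProfile canonicalPartition_eq_posPartition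
  posPartition_pos localMaxwellian_pos isProbabilityMeasure_localGibbsLaw)
open Literature.Probability.Divergences (klDiv_le_of_forall_integral_le
  integral_le_toReal_klDiv_add_log)

/-! ### The abstract core: a Rényi bound between two densities controls the entropy transfer -/

section Abstract

variable {α : Type*} [MeasurableSpace α]

/-- HÖLDER STEP. For measurable `ρ, ρ' : α → ℝ≥0∞` with `ρ' ≠ 0, ∞` a.e., Hölder exponents
`p⁻¹ + c⁻¹ = 1` and a measurable real `φ`:
`∫ ρ e^{φ/c} dL ≤ (∫ ρ' e^{φ} dL)^{1/c} · (∫ ρ^p ρ'^{1-p} dL)^{1/p}`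
(Hölder in `ℝ≥0∞` for `f = e^{φ/c} ρ'^{1/c}`, `g = ρ ρ'^{-1/c}`, using `p/c = p - 1`). [folklore] -/
theorem eqi_lintegral_mul_exp_le {L : Measure α} {ρ ρ' : α → ℝ≥0∞} (hρ : Measurable ρ)
    (hρ' : Measurable ρ') (h0 : ∀ᵐ z ∂L, ρ' z ≠ 0) (ht : ∀ᵐ z ∂L, ρ' z ≠ ∞)
    {p c : ℝ} (hpc : p.HolderConjugate c) {φ : α → ℝ} (hφ : Measurable φ) :
    ∫⁻ z, ρ z * ENNReal.ofReal (Real.exp (φ z / c)) ∂L ≤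
      (∫⁻ z, ρ' z * ENNReal.ofReal (Real.exp (φ z)) ∂L) ^ (1 / c) *
        (∫⁻ z, ρ z ^ p * ρ' z ^ (1 - p) ∂L) ^ (1 / p) := by
  set f : α → ℝ≥0∞ := fun z => ENNReal.ofReal (Real.exp (φ z / c)) * ρ' z ^ (1 / c) with hf
  set g : α → ℝ≥0∞ := fun z => ρ z * (ρ' z)⁻¹ ^ (1 / c) with hg
  have hfm : Measurable f := (hφ.div_const c).exp.ennreal_ofReal.mul (hρ'.pow_const _)
  have hgm : Measurable g := hρ.mul (hρ'.inv.pow_const _)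
  have hc0 : c ≠ 0 := hpc.symm.ne_zero
  have h1 : ∫⁻ z, ρ z * ENNReal.ofReal (Real.exp (φ z / c)) ∂L = ∫⁻ z, (f * g) z ∂L := by
    refine lintegral_congr_ae ?_
    filter_upwards [h0, ht] with z hz0 hzt
    simp only [hf, hg, Pi.mul_apply]
    calc ρ z * ENNReal.ofReal (Real.exp (φ z / c))
        = ρ z * ENNReal.ofReal (Real.exp (φ z / c)) * (ρ' z * (ρ' z)⁻¹) ^ (1 / c) := by
          rw [ENNReal.mul_inv_cancel hz0 hzt, ENNReal.one_rpow, mul_one]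
      _ = ENNReal.ofReal (Real.exp (φ z / c)) * ρ' z ^ (1 / c) * (ρ z * (ρ' z)⁻¹ ^ (1 / c)) := by
          rw [ENNReal.mul_rpow_of_nonneg _ _ hpc.symm.one_div_nonneg]; ring
  have h2f : ∫⁻ z, f z ^ c ∂L = ∫⁻ z, ρ' z * ENNReal.ofReal (Real.exp (φ z)) ∂L := by
    refine lintegral_congr fun z => ?_
    simp only [hf]
    rw [ENNReal.mul_rpow_of_nonneg _ _ hpc.symm.nonneg, ← ENNReal.rpow_mul,
      one_div_mul_cancel hc0, ENNReal.rpow_one,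
      ENNReal.ofReal_rpow_of_nonneg (Real.exp_pos _).le hpc.symm.nonneg, ← Real.exp_mul,
      div_mul_cancel₀ _ hc0, mul_comm]
  have h2g : ∫⁻ z, g z ^ p ∂L = ∫⁻ z, ρ z ^ p * ρ' z ^ (1 - p) ∂L := by
    refine lintegral_congr fun z => ?_
    simp only [hg]
    rw [ENNReal.mul_rpow_of_nonneg _ _ hpc.nonneg, ← ENNReal.rpow_mul, ENNReal.inv_rpow,
      ← ENNReal.rpow_neg]
    congr 2
    rw [one_div_mul_eq_div, hpc.div_conj_eq_sub_one]
    ring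
  rw [h1, ← h2f, ← h2g]
  exact ENNReal.lintegral_mul_le_Lp_mul_Lq L hpc.symm hfm.aemeasurable hgm.aemeasurable

/-- The exponential of a function bounded in absolute value by `C` is integrable against a
probability measure. [folklore] -/
theorem eqi_integrable_exp {μ : Measure α} [IsProbabilityMeasure μ] {φ : α → ℝ}
    (hφ : Measurable φ) {C : ℝ} (hC : ∀ x, φ x ≤ C) :
    Integrable (fun x => Real.exp (φ x)) μ :=
  Integrable.of_bound hφ.exp.aestronglyMeasurable (Real.exp C) (ae_of_all _ fun x => by
    rw [Real.norm_eq_abs, abs_of_pos (Real.exp_pos _)]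
    exact Real.exp_le_exp.2 (hC x))

/-- `ofReal (∫ e^φ d(ρL)) = ∫⁻ ρ · ofReal (e^φ) dL` for a bounded-above measurable `φ` and a
probability measure `ρL`. [folklore] -/
theorem eqi_ofReal_integral_exp_withDensity {L : Measure α} {ρ : α → ℝ≥0∞} (hρ : Measurable ρ)
    [IsProbabilityMeasure (L.withDensity ρ)] {φ : α → ℝ} (hφ : Measurable φ) {C : ℝ}
    (hC : ∀ x, φ x ≤ C) :
    ENNReal.ofReal (∫ x, Real.exp (φ x) ∂L.withDensity ρ) =
      ∫⁻ z, ρ z * ENNReal.ofReal (Real.exp (φ z)) ∂L := by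
  rw [ofReal_integral_eq_lintegral_ofReal (eqi_integrable_exp hφ hC)
      (ae_of_all _ fun x => (Real.exp_pos _).le),
    lintegral_withDensity_eq_lintegral_mul _ hρ hφ.exp.ennreal_ofReal]
  rfl

/-- LOG-HÖLDER STEP. For probability measures `ρL`, `ρ'L` (`ρ' ≠ 0, ∞` a.e.), Hölder exponents
`p⁻¹ + c⁻¹ = 1`, the Rényi bound `∫ ρ^p ρ'^{1-p} dL ≤ e^{(p-1)E}` and a bounded measurable `φ`:
`c · log ∫ e^{φ/c} d(ρL) ≤ log ∫ e^{φ} d(ρ'L) + E` (logarithm of `eqi_lintegral_mul_exp_le`, using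
`(p-1)/p = 1/c`). [folklore] -/
theorem eqi_mul_log_le {L : Measure α} {ρ ρ' : α → ℝ≥0∞} (hρ : Measurable ρ)
    (hρ' : Measurable ρ') [IsProbabilityMeasure (L.withDensity ρ)]
    [IsProbabilityMeasure (L.withDensity ρ')] (h0 : ∀ᵐ z ∂L, ρ' z ≠ 0) (ht : ∀ᵐ z ∂L, ρ' z ≠ ∞)
    {p c : ℝ} (hpc : p.HolderConjugate c) {E : ℝ}
    (hR : ∫⁻ z, ρ z ^ p * ρ' z ^ (1 - p) ∂L ≤ ENNReal.ofReal (Real.exp ((p - 1) * E)))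
    {φ : α → ℝ} (hφ : Measurable φ) {C : ℝ} (hC : ∀ x, |φ x| ≤ C) :
    c * Real.log (∫ x, Real.exp (φ x / c) ∂L.withDensity ρ) ≤
      Real.log (∫ x, Real.exp (φ x) ∂L.withDensity ρ') + E := by
  have hc : 0 < c := hpc.symm.pos
  set A : ℝ := ∫ x, Real.exp (φ x / c) ∂L.withDensity ρ with hAdef
  set B : ℝ := ∫ x, Real.exp (φ x) ∂L.withDensity ρ' with hBdef
  have hCB : ∀ x, φ x ≤ C := fun x => (le_abs_self _).trans (hC x)
  have hCA : ∀ x, φ x / c ≤ C / c := fun x => div_le_div_of_nonneg_right (hCB x) hc.le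
  have hA : 0 < A := integral_exp_pos (eqi_integrable_exp (hφ.div_const c) hCA)
  have hB : 0 < B := integral_exp_pos (eqi_integrable_exp hφ hCB)
  -- Hölder in `ℝ≥0∞`, read back in `ℝ`
  have hH := eqi_lintegral_mul_exp_le hρ hρ' h0 ht hpc hφ
  rw [← eqi_ofReal_integral_exp_withDensity hρ (hφ.div_const c) hCA,
    ← eqi_ofReal_integral_exp_withDensity hρ' hφ hCB] at hH
  have hexp : (p - 1) * E * (1 / p) = E / c := by
    rw [← hpc.div_conj_eq_sub_one]
    field_simp
    exact mul_div_cancel_left₀ E hpc.ne_zero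
  have hRp : (∫⁻ z, ρ z ^ p * ρ' z ^ (1 - p) ∂L) ^ (1 / p) ≤ ENNReal.ofReal (Real.exp (E / c)) := by
    refine (ENNReal.rpow_le_rpow hR hpc.one_div_nonneg).trans_eq ?_
    rw [ENNReal.ofReal_rpow_of_nonneg (Real.exp_pos _).le hpc.one_div_nonneg, ← Real.exp_mul, hexp]
  have hle : ENNReal.ofReal A ≤ ENNReal.ofReal (B ^ (1 / c) * Real.exp (E / c)) := by
    calc ENNReal.ofReal A
        ≤ ENNReal.ofReal B ^ (1 / c) * (∫⁻ z, ρ z ^ p * ρ' z ^ (1 - p) ∂L) ^ (1 / p) := hH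
      _ ≤ ENNReal.ofReal B ^ (1 / c) * ENNReal.ofReal (Real.exp (E / c)) := by gcongr
      _ = ENNReal.ofReal (B ^ (1 / c) * Real.exp (E / c)) := by
          rw [ENNReal.ofReal_rpow_of_nonneg hB.le hpc.symm.one_div_nonneg,
            ENNReal.ofReal_mul (Real.rpow_nonneg hB.le _)]
  have hle' : A ≤ B ^ (1 / c) * Real.exp (E / c) :=
    (ENNReal.ofReal_le_ofReal_iff (by positivity)).1 hle
  have hlog : Real.log A ≤ 1 / c * Real.log B + E / c := by
    have h := Real.log_le_log hA hle'
    rwa [Real.log_mul (Real.rpow_pos_of_pos hB _).ne' (Real.exp_pos _).ne', Real.log_rpow hB,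
      Real.log_exp] at h
  calc c * Real.log A ≤ c * (1 / c * Real.log B + E / c) := mul_le_mul_of_nonneg_left hlog hc.le
    _ = Real.log B + E := by field_simp

/-- **ABSTRACT CORE: a Rényi bound controls the transfer of relative entropy between two
references.** Let `ρL` and `ρ'L` be probability measures (`ρ, ρ'` measurable, `ρ' ≠ 0, ∞` a.e.),
`p⁻¹ + c⁻¹ = 1`, and assume the Rényi-type bound `∫ ρ^p ρ'^{1-p} dL ≤ e^{(p-1)E}`. Then for EVERY
probability measure `P`: `KL(P ‖ ρ'L) ≤ c · KL(P ‖ ρL) + E`.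
Proof: if `KL(P‖ρL) = ∞` there is nothing to prove; otherwise, for a bounded measurable `φ`, the easy
half of Donsker–Varadhan with the test function `φ/c` gives `∫ φ dP ≤ c KL(P‖ρL) + c log ∫ e^{φ/c} d(ρL)`,
the log-Hölder step bounds the last term by `log ∫ e^φ d(ρ'L) + E`, and the hard half of
Donsker–Varadhan concludes. (Equivalently: `KL(P‖ν') = KL(P‖ν) + E_P[log(dν/dν')]` and the entropy
inequality.) [folklore] -/
theorem eqi_klDiv_le_of_renyi {L : Measure α} {ρ ρ' : α → ℝ≥0∞} (hρ : Measurable ρ)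
    (hρ' : Measurable ρ') [IsProbabilityMeasure (L.withDensity ρ)]
    [IsProbabilityMeasure (L.withDensity ρ')] (h0 : ∀ᵐ z ∂L, ρ' z ≠ 0) (ht : ∀ᵐ z ∂L, ρ' z ≠ ∞)
    {p c : ℝ} (hpc : p.HolderConjugate c) (E : ℝ)
    (hR : ∫⁻ z, ρ z ^ p * ρ' z ^ (1 - p) ∂L ≤ ENNReal.ofReal (Real.exp ((p - 1) * E)))
    (P : Measure α) [IsProbabilityMeasure P] :
    klDiv P (L.withDensity ρ') ≤
      ENNReal.ofReal c * klDiv P (L.withDensity ρ) + ENNReal.ofReal E := by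
  have hc : 0 < c := hpc.symm.pos
  by_cases hfin : klDiv P (L.withDensity ρ) = ∞
  · rw [hfin, ENNReal.mul_top (ENNReal.ofReal_pos.2 hc).ne', top_add]
    exact le_top
  set K : ℝ := (klDiv P (L.withDensity ρ)).toReal with hK
  have hmain : klDiv P (L.withDensity ρ') ≤ ENNReal.ofReal (c * K + E) := by
    refine klDiv_le_of_forall_integral_le fun φ C hφ hC => ?_
    have hCc : ∀ x, |φ x / c| ≤ C / c := fun x => by
      rw [abs_div, abs_of_pos hc]
      exact div_le_div_of_nonneg_right (hC x) hc.le
    have h1 := integral_le_toReal_klDiv_add_log hfin (hφ.div_const c) hCc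
    have h2 := eqi_mul_log_le hρ hρ' h0 ht hpc hR hφ hC
    have h3 : ∫ x, φ x ∂P = c * ∫ x, φ x / c ∂P := by
      rw [integral_div, mul_div_cancel₀ _ hc.ne']
    rw [h3]
    calc c * ∫ x, φ x / c ∂P
        ≤ c * (K + Real.log (∫ x, Real.exp (φ x / c) ∂L.withDensity ρ)) :=
          mul_le_mul_of_nonneg_left h1 hc.le
      _ = c * K + c * Real.log (∫ x, Real.exp (φ x / c) ∂L.withDensity ρ) := mul_add _ _ _
      _ ≤ c * K + (Real.log (∫ x, Real.exp (φ x) ∂L.withDensity ρ') + E) := by gcongr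
      _ = c * K + E + Real.log (∫ x, Real.exp (φ x) ∂L.withDensity ρ') := by ring
  calc klDiv P (L.withDensity ρ') ≤ ENNReal.ofReal (c * K + E) := hmain
    _ ≤ ENNReal.ofReal (c * K) + ENNReal.ofReal E := ENNReal.ofReal_add_le
    _ = ENNReal.ofReal c * klDiv P (L.withDensity ρ) + ENNReal.ofReal E := by
        rw [ENNReal.ofReal_mul hc.le, hK, ENNReal.ofReal_toReal hfin]

end Abstract

/-! ### The hard-sphere / local Gibbs instance -/

/-- The canonical density of the local Gibbs profile is positive on the hard-sphere domain
(`a, θ₀ > 0` continuous, `σ ≤ 1/2`). [folklore] -/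
theorem eqi_canonicalDensity_pos_of_mem {σ : ℝ} {a θ₀ : T3 → ℝ} {u₀ : T3 → V3}
    (ha : Continuous a) (hθ : Continuous θ₀) (hu : Continuous u₀)
    (ha0 : ∀ x, 0 < a x) (hθ0 : ∀ x, 0 < θ₀ x) (hσ2 : σ ≤ 1 / 2) {N : ℕ}
    {z : Config (N + 1) (Fin 3) T3}
    (hz : z ∈ hardSphereDomain (Literature.Analysis.FluidPDE.Torus.geometry (Fin 3)) (N + 1)
      (hsDiameter σ N)) :
    0 < canonicalDensity (Literature.Analysis.FluidPDE.Torus.geometry (Fin 3)) (hsDiameter σ N) (N + 1)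
      (localGibbsProfile a u₀ θ₀) z := by
  -- adapted from `KineticCurrentsWindowLDUniformSketch.canonicalDensity_pos_of_mem` (private there)
  unfold canonicalDensity
  rw [Set.indicator_of_mem hz, canonicalPartition_eq_posPartition ha hθ hu (fun x => (ha0 x).le) hθ0]
  refine mul_pos (inv_pos.2 (posPartition_pos ha ha0 hσ2 N)) ?_
  exact Finset.prod_pos fun i _ => mul_pos (ha0 _) (localMaxwellian_pos one_pos (hθ0 _) _ _)

/-- LIOUVILLE CHANGE OF VARIABLES in the Rényi integral: for a measurable `ψ : Config → ℝ≥0∞`, a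
hard-sphere flow `Φ` and real `p, r`,
`∫ ψ^p (ψ∘Φ_r)^{1-p} dL = ∫ (ψ∘Φ_{-r})^p ψ^{1-p} dL` (`Φ_r` preserves `L`, and `Φ_{-r} ∘ Φ_r = id` on
the conull good set). [folklore] -/
theorem eqi_lintegral_renyi_comp_flow {σ : ℝ} {N : ℕ}
    (Φ : HardSphereFlow (Literature.Analysis.FluidPDE.Torus.geometry (Fin 3)) (hsDiameter σ N) (N + 1))
    {ψ : Config (N + 1) (Fin 3) T3 → ℝ≥0∞} (hψ : Measurable ψ) (p r : ℝ) :
    ∫⁻ z, ψ z ^ p * ψ (Φ.flow r z) ^ (1 - p)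
        ∂(liouville (Literature.Analysis.FluidPDE.Torus.geometry (Fin 3)) (N + 1) (hsDiameter σ N)) =
      ∫⁻ z, ψ (Φ.flow (-r) z) ^ p * ψ z ^ (1 - p)
        ∂(liouville (Literature.Analysis.FluidPDE.Torus.geometry (Fin 3)) (N + 1) (hsDiameter σ N)) := by
  have hH : Measurable fun w => ψ (Φ.flow (-r) w) ^ p * ψ w ^ (1 - p) :=
    ((hψ.comp (Φ.measurable_flow (-r))).pow_const p).mul (hψ.pow_const _)
  have hae : (fun z => ψ z ^ p * ψ (Φ.flow r z) ^ (1 - p))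
      =ᵐ[liouville (Literature.Analysis.FluidPDE.Torus.geometry (Fin 3)) (N + 1) (hsDiameter σ N)]
      fun z => (fun w => ψ (Φ.flow (-r) w) ^ p * ψ w ^ (1 - p)) (Φ.flow r z) := by
    filter_upwards [Φ.ae_mem_good] with z hz
    simp only [Φ.flow_neg_flow r hz]
  rw [lintegral_congr_ae hae]
  exact (Φ.measurePreserving r).lintegral_comp hH

/-- **S5 at fixed `N`, `r`, flow and law.** If the canonical local Gibbs density `ψ` satisfies the
Rényi bound `∫ (ψ∘Φ_{-r})^p ψ^{1-p} dL ≤ e^{(p-1)E}` (`L` the Liouville measure) and `p⁻¹ + c⁻¹ = 1`,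
then for every probability law `P`: `KL((Φ_r)_* P ‖ λ) ≤ c · KL(P ‖ λ) + E`, `λ = ψ dL` the local Gibbs
law. Proof: WLOG `KL(P‖λ) < ∞`, so `P ≪ λ ≪ L`; transport `KL((Φ_r)_*P ‖ λ) = KL(P ‖ (Φ_{-r})_*λ)`
(`Theorems.klDiv_lawAt_eq`) and `(Φ_{-r})_*λ = (ψ∘Φ_r) dL` (mild Liouville equation); then
`eqi_klDiv_le_of_renyi` with `ρ = ψ`, `ρ' = ψ∘Φ_r` (positive a.e.: the good set is invariant, conull
and inside the hard-sphere domain) after the change of variables `eqi_lintegral_renyi_comp_flow`.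
[cite: Yau1991, §2] -/
theorem eqi_fixed {σ : ℝ} {a θ₀ : T3 → ℝ} {u₀ : T3 → V3}
    (ha : Continuous a) (hθ : Continuous θ₀) (hu : Continuous u₀)
    (ha0 : ∀ x, 0 < a x) (hθ0 : ∀ x, 0 < θ₀ x) (hσ2 : σ ≤ 1 / 2) {N : ℕ}
    (Φ : HardSphereFlow (Literature.Analysis.FluidPDE.Torus.geometry (Fin 3)) (hsDiameter σ N) (N + 1))
    {p c : ℝ} (hpc : p.HolderConjugate c) (r : ℝ) {E : ℝ}
    (hR : ∫⁻ z, ENNReal.ofReal (canonicalDensity (Literature.Analysis.FluidPDE.Torus.geometry (Fin 3))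
              (hsDiameter σ N) (N + 1) (localGibbsProfile a u₀ θ₀) (Φ.flow (-r) z)) ^ p *
            ENNReal.ofReal (canonicalDensity (Literature.Analysis.FluidPDE.Torus.geometry (Fin 3))
              (hsDiameter σ N) (N + 1) (localGibbsProfile a u₀ θ₀) z) ^ (1 - p)
          ∂(liouville (Literature.Analysis.FluidPDE.Torus.geometry (Fin 3)) (N + 1) (hsDiameter σ N)) ≤
        ENNReal.ofReal (Real.exp ((p - 1) * E)))
    (P : Measure (Config (N + 1) (Fin 3) T3)) [IsProbabilityMeasure P] :
    klDiv (P.map (Φ.flow r)) (localGibbsLaw σ a u₀ θ₀ N Φ) ≤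
      ENNReal.ofReal c * klDiv P (localGibbsLaw σ a u₀ θ₀ N Φ) + ENNReal.ofReal E := by
  set L := liouville (Literature.Analysis.FluidPDE.Torus.geometry (Fin 3)) (N + 1) (hsDiameter σ N)
    with hL
  set ψ : Config (N + 1) (Fin 3) T3 → ℝ≥0∞ := fun z => ENNReal.ofReal
    (canonicalDensity (Literature.Analysis.FluidPDE.Torus.geometry (Fin 3)) (hsDiameter σ N) (N + 1)
      (localGibbsProfile a u₀ θ₀) z) with hψ
  have hlaw : localGibbsLaw σ a u₀ θ₀ N Φ = L.withDensity ψ := by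
    simp only [localGibbsLaw, particleLaw_eq, hL, hψ]
  have hψm : Measurable ψ :=
    (measurable_canonicalDensity (hsDiameter σ N) (N + 1)
      (measurable_localGibbsProfile ha hθ hu)).ennreal_ofReal
  haveI hlam : IsProbabilityMeasure (localGibbsLaw σ a u₀ θ₀ N Φ) :=
    isProbabilityMeasure_localGibbsLaw ha hθ hu ha0 hθ0 hσ2 N Φ
  have hc : 0 < c := hpc.symm.pos
  -- the case `KL(P‖λ) = ∞`
  by_cases hfin : klDiv P (localGibbsLaw σ a u₀ θ₀ N Φ) = ∞
  · rw [hfin, ENNReal.mul_top (ENNReal.ofReal_pos.2 hc).ne', top_add]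
    exact le_top
  have hlamac : localGibbsLaw σ a u₀ θ₀ N Φ ≪ L := hlaw ▸ withDensity_absolutelyContinuous _ _
  have hPac : P ≪ L := (klDiv_ne_top_iff.1 hfin).1.trans hlamac
  -- transport along the flow and the mild Liouville equation
  have hmap : (localGibbsLaw σ a u₀ θ₀ N Φ).map (Φ.flow (-r)) =
      L.withDensity fun z => ψ (Φ.flow r z) := by
    have h := HardSphereFlow.lawAt_withDensity_holds Φ hψm (-r)
    rw [HardSphereFlow.lawAt_eq] at h
    rw [hlaw, h]
    congr 1
    funext z
    simp [HardSphereFlow.transportDensity]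
  haveI hlam' : IsProbabilityMeasure (L.withDensity fun z => ψ (Φ.flow r z)) := by
    rw [← hmap]
    exact Measure.isProbabilityMeasure_map (Φ.measurable_flow (-r)).aemeasurable
  haveI hlam'' : IsProbabilityMeasure (L.withDensity ψ) := hlaw ▸ hlam
  rw [← HardSphereFlow.lawAt_eq, Theorems.klDiv_lawAt_eq Φ P _ hPac hlamac r, hmap, hlaw]
  -- the abstract core with `ρ = ψ`, `ρ' = ψ ∘ Φ_r`
  refine eqi_klDiv_le_of_renyi (ρ' := fun z => ψ (Φ.flow r z)) hψm
    (hψm.comp (Φ.measurable_flow r)) ?_ (ae_of_all _ fun z => ENNReal.ofReal_ne_top) hpc E ?_ P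
  · filter_upwards [Φ.ae_mem_good] with z hz
    exact (ENNReal.ofReal_pos.2 (eqi_canonicalDensity_pos_of_mem ha hθ hu ha0 hθ0 hσ2
      (Φ.good_subset (Φ.mapsTo_good r hz)))).ne'
  · rw [eqi_lintegral_renyi_comp_flow Φ hψm p r]
    exact hR

/-- S5 — ENTROPY-LEVEL QUASI-INVARIANCE FROM RÉNYI (M, provable over the tree: `klDiv_lawAt_eq`, Liouville
transport of the density, the easy half of Donsker–Varadhan). Given S4 (order `p`), with `c = p/(p-1)`: for
every window parameter `τ`, `δ > 0`, flow family, all large `N`, all `r ∈ [0, τ(N+1)^{-1/3}]` and EVERY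
probability law `P` of the initial data, `KL(P∘Φ_r⁻¹ ‖ λ^N) ≤ c · KL(P ‖ λ^N) + δ(N+1)`:
`KL(P∘Φ_r⁻¹‖λ) = KL(P‖(Φ_{-r})_*λ) = KL(P‖λ) + E_P[log(ψ/ψ∘Φ_r)]` and the entropy inequality
`E_P[(p-1) log(ψ/ψ∘Φ_r)] ≤ KL(P‖λ) + log ∫ ψ^p (ψ∘Φ_r)^{1-p} dL`, the last integral being S4's after the
Liouville-preserving change of variables `z ↦ Φ_{-r} z`. This is the form the ledger consumes (triage r1-2:
"replace `E_{q*}[D_r] = o(N)` by `H(q*_r|λ) ≤ (1+1/γ)H(q*|λ) + D_{1+γ}(λ_r‖λ)`"). -/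
theorem stub_entropyQuasiInvariance_of_renyi :
    (∀ (a θ₀ : T3 → ℝ) (u₀ : T3 → V3), Continuous a → Continuous θ₀ → Continuous u₀ →
      (∀ x, 0 < a x) → (∀ x, 0 < θ₀ x) → ∀ σ : ℝ, 0 < σ → σ ≤ 1 / 2 →
      ∃ p : ℝ, 1 < p ∧ ∀ τ : ℝ, 0 < τ → ∀ δ : ℝ, 0 < δ →
      ∀ Φ : (N : ℕ) →
        HardSphereFlow (Literature.Analysis.FluidPDE.Torus.geometry (Fin 3)) (hsDiameter σ N) (N + 1),
      ∃ N₀ : ℕ, ∀ N : ℕ, N₀ ≤ N → ∀ r ∈ Set.Icc (0 : ℝ) (τ * ((N : ℝ) + 1) ^ (-(1 / 3 : ℝ))),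
        ∫⁻ z, ENNReal.ofReal (canonicalDensity (Literature.Analysis.FluidPDE.Torus.geometry (Fin 3))
              (hsDiameter σ N) (N + 1) (localGibbsProfile a u₀ θ₀) ((Φ N).flow (-r) z)) ^ p *
            ENNReal.ofReal (canonicalDensity (Literature.Analysis.FluidPDE.Torus.geometry (Fin 3))
              (hsDiameter σ N) (N + 1) (localGibbsProfile a u₀ θ₀) z) ^ (1 - p)
          ∂(liouville (Literature.Analysis.FluidPDE.Torus.geometry (Fin 3)) (N + 1) (hsDiameter σ N)) ≤
        ENNReal.ofReal (Real.exp (p * (δ * ((N : ℝ) + 1))))) →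
    ∀ (a θ₀ : T3 → ℝ) (u₀ : T3 → V3), Continuous a → Continuous θ₀ → Continuous u₀ →
      (∀ x, 0 < a x) → (∀ x, 0 < θ₀ x) → ∀ σ : ℝ, 0 < σ → σ ≤ 1 / 2 →
      ∃ c : ℝ, 1 ≤ c ∧ ∀ τ : ℝ, 0 < τ → ∀ δ : ℝ, 0 < δ →
      ∀ Φ : (N : ℕ) →
        HardSphereFlow (Literature.Analysis.FluidPDE.Torus.geometry (Fin 3)) (hsDiameter σ N) (N + 1),
      ∃ N₀ : ℕ, ∀ N : ℕ, N₀ ≤ N → ∀ r ∈ Set.Icc (0 : ℝ) (τ * ((N : ℝ) + 1) ^ (-(1 / 3 : ℝ))),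
      ∀ (P : Measure (Config (N + 1) (Fin 3) T3)) [IsProbabilityMeasure P],
        klDiv (P.map ((Φ N).flow r)) (localGibbsLaw σ a u₀ θ₀ N (Φ N)) ≤
          ENNReal.ofReal c * klDiv P (localGibbsLaw σ a u₀ θ₀ N (Φ N)) +
            ENNReal.ofReal (δ * ((N : ℝ) + 1)) := by
  intro hRenyi a θ₀ u₀ ha hθ hu ha0 hθ0 σ hσ hσ2
  obtain ⟨p, hp1, hp⟩ := hRenyi a θ₀ u₀ ha hθ hu ha0 hθ0 σ hσ hσ2
  have hpc : p.HolderConjugate (Real.conjExponent p) := Real.HolderConjugate.conjExponent hp1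
  refine ⟨Real.conjExponent p, hpc.symm.lt.le, ?_⟩
  intro τ hτ δ hδ Φ
  have hδ' : 0 < δ * (p - 1) / p := div_pos (mul_pos hδ hpc.sub_one_pos) hpc.pos
  obtain ⟨N₀, hN₀⟩ := hp τ hτ (δ * (p - 1) / p) hδ' Φ
  refine ⟨N₀, fun N hN r hr P _ => ?_⟩
  have hR := hN₀ N hN r hr
  have heq : p * (δ * (p - 1) / p * ((N : ℝ) + 1)) = (p - 1) * (δ * ((N : ℝ) + 1)) := by
    field_simp
  rw [heq] at hR
  exact eqi_fixed ha hθ hu ha0 hθ0 hσ2 (Φ N) hpc r hR P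

end Summit.AtomisticToContinuum.HydrodynamicLimit.Theorems.KineticCurrentsWindowLDUniformLocalGibbs

end
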